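import Summits.QuantumFields.YangMills.Theorems.FixedTorusFirstTorusOnePoint
import Summits.QuantumFields.YangMills.Theorems.FixedTorusFirstFunctionalRungEnvelope
import HarnessLib

/-!
# `FixedTorusFirst` — the functional strong-coupling rung of `FiniteSizeInsensitivity`

Route `route-QuantumFields-FixedTorusFirst` (sub-line under `BalabanLadder.NT`, ladder rung R2a),
crux `Summit.QuantumFields.YangMills.Theses.FixedTorusFirst.FiniteSizeInsensitivity` (item
`stmt-QuantumFields-27355`; clauses (a), (b): torus-size CAUCHY property of NT's own smeared
functionals `Q2 G r β L (a β) (θv) v` and `Q3 G r β L (a β) f g h` along `β → ∞`).  This file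
proves the SAME two clauses on the complementary, strong-coupling window — a second BC5 witness of
the crux, now in the crux's own language (the first, `rung_strongCouplingFiniteSize`, is
observable-level):

* `rung_functional_strongCoupling` — for every compact `G` and every lattice representation `r`
  there is `β₀ > 0` such that for every bound `s₀` on the unit, all compactly supported real
  Schwartz `f, g (, h)` and every `η > 0` there is `Λ₆` with
  `|Q2 G r β L s f g − Q2 G r β L' s f g| ≤ η` (resp. `|Q3 … L … − Q3 … L' …| ≤ η`) for all
  `|β| ≤ β₀`, all units `0 < s ≤ s₀` and all tori with `s·L, s·L' ≥ Λ₆` — uniformly in the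
  unit, with NO positive-time or disjointness hypothesis on the test functions;
* `finiteSizeInsensitivity_strongCoupling` — the same in the binder shape of the crux (unit map
  `a`, `θv` against `v`, Borel σ-algebra).

Mechanism: compact supports put every smearing site in the box of radius `N = ⌊R/s⌋`; each of
the `(2N+1)⁸` (resp. `(2N+1)¹²`) summands is a covariance (third cumulant) of action densities,
whose torus means move by `≤ C^j · 2(2N+3)⁴ 2^{−⌊(L−2−N)/3⌋}` between the tori
(`torusE_dens_finiteSize`: Dobrushin–Shlosman finite-size condition + influence chain rule +
torus DLR, far factor `1`); the polynomial `(2N+3)^{12}` (`^{16}`) in `1/s` is absorbed by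
`2^{−Λ₆/(6s)}` uniformly in `s ≤ s₀` (`envelope_le`), leaving `const/Λ₆`.

Lattice strong coupling only: nothing here is asserted about `β → ∞`, the continuum limit, the
mass gap, `SomeTorusFloors`, `NT` or the summit.  References: Dobrushin–Shlosman (1985) §2
[cite: DobrushinShlosman1985, §2]; Georgii (2011) §8.2 [cite: Georgii2011, §8.2]; Lüscher (1986)
[cite: Luscher1986] for the weak-coupling expectation the crux encodes.
-/

set_option autoImplicit false

noncomputable section

open scoped SchwartzMap
open MeasureTheory Filter
open Literature.Probability.LatticeModels
open Literature.MathematicalPhysics.QuantumLattice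
open Literature.MathematicalPhysics.QuantumFieldTheory (LatticeRep IsCompactSimpleLieGroup)
open Summit.QuantumFields.YangMills.Cruxes.OSLegsFromFemtoAndGap.DlrCollarTransfer (dens torusE Q2
  Q3 torusK3)

namespace Summit.QuantumFields.YangMills.Cruxes.FiniteSizeInsensitivity.Rung

/-! ## The functional strong-coupling rung -/

section Functional

variable {G : Type} [Group G] [TopologicalSpace G] [IsTopologicalGroup G] [CompactSpace G]
  [MeasurableSpace G] [BorelSpace G] (r : LatticeRep G)

/-- **Functional strong-coupling rung of `FixedTorusFirst.FiniteSizeInsensitivity`.**  For every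
compact `G` and lattice representation `r` there is `β₀ > 0` such that, for every unit bound
`s₀`, clauses (a) and (b) of the crux — the torus-size Cauchy property of `Q2 G r β L s f g` and
`Q3 G r β L s f g h` — hold for all `|β| ≤ β₀`, uniformly in the unit `0 < s ≤ s₀`, for ALL
compactly supported real Schwartz test functions (no positive-time or disjointness hypothesis).
Lattice strong coupling; says nothing about `β → ∞`. -/
theorem rung_functional_strongCoupling : ∃ β₀ : ℝ, 0 < β₀ ∧ ∀ s₀ : ℝ, 0 < s₀ →
    (∀ (f g : 𝓢(EuclideanSpace ℝ (Fin 4), ℝ)),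
      HasCompactSupport (f : EuclideanSpace ℝ (Fin 4) → ℝ) →
      HasCompactSupport (g : EuclideanSpace ℝ (Fin 4) → ℝ) →
      ∀ η : ℝ, 0 < η → ∃ Λ₆ : ℝ, ∀ β : ℝ, |β| ≤ β₀ →
        ∀ s : ℝ, 0 < s → s ≤ s₀ →
        ∀ L L' : ℕ, Λ₆ ≤ s * L → Λ₆ ≤ s * L' → |Q2 G r β L s f g - Q2 G r β L' s f g| ≤ η) ∧
    (∀ (f g h : 𝓢(EuclideanSpace ℝ (Fin 4), ℝ)),
      HasCompactSupport (f : EuclideanSpace ℝ (Fin 4) → ℝ) →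
      HasCompactSupport (g : EuclideanSpace ℝ (Fin 4) → ℝ) →
      HasCompactSupport (h : EuclideanSpace ℝ (Fin 4) → ℝ) →
      ∀ η : ℝ, 0 < η → ∃ Λ₆ : ℝ, ∀ β : ℝ, |β| ≤ β₀ →
        ∀ s : ℝ, 0 < s → s ≤ s₀ →
        ∀ L L' : ℕ, Λ₆ ≤ s * L → Λ₆ ≤ s * L' →
          |Q3 G r β L s f g h - Q3 G r β L' s f g h| ≤ η) := by
  classical
  obtain ⟨β₀, hβ₀, C, hC0, hC, hE1, hE2, hE3, hFS⟩ := torusE_dens_finiteSize r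
  have hlog2 : 0 < Real.log 2 := Real.log_pos (by norm_num)
  have hcard : ∀ N : ℕ, ((box 4 N).card : ℝ) = (2 * N + 1) ^ 4 := fun N => by
    rw [card_box]; push_cast; ring
  refine ⟨β₀, hβ₀, fun s₀ hs₀ => ⟨?_, ?_⟩⟩
  · intro f g hf hg η hη
    obtain ⟨Mf, Rf, hMf0, hRf0, hMf, hRf⟩ := exists_bound_and_radius f hf
    obtain ⟨Mg, Rg, hMg0, hRg0, hMg, hRg⟩ := exists_bound_and_radius g hg
    obtain ⟨R, hR⟩ : ∃ R : ℝ, R = max Rf Rg := ⟨_, rfl⟩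
    have hR0 : 0 < R := by rw [hR]; exact lt_max_of_lt_left hRf0
    have hRfR : Rf ≤ R := by rw [hR]; exact le_max_left _ _
    have hRgR : Rg ≤ R := by rw [hR]; exact le_max_right _ _
    obtain ⟨P, hP⟩ : ∃ P : ℝ, P = 6 * Mf * Mg * C ^ 2 := ⟨_, rfl⟩
    have hP0 : 0 ≤ P := by rw [hP]; positivity
    refine ⟨max (2 * R + 8 * s₀ + 1)
      (P * (2 * R + 3 * s₀) ^ 12 * (6 * (12 : ℕ) / Real.log 2) ^ 12 / η + 1), ?_⟩
    intro β hβ s hs hss₀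
    have hRs : R / s < (⌊R / s⌋₊ : ℕ) + 1 := Nat.lt_floor_add_one _
    have hvf : ∀ x : Site 4, x ∉ box 4 ⌊R / s⌋₊ → f (s • siteToE x) = 0 :=
      fun x hx => test_vanish hRf hRfR hs hRs hx
    have hvg : ∀ y : Site 4, y ∉ box 4 ⌊R / s⌋₊ → g (s • siteToE y) = 0 :=
      fun y hy => test_vanish hRg hRgR hs hRs hy
    have key : ∀ L L' : ℕ, max (2 * R + 8 * s₀ + 1)
        (P * (2 * R + 3 * s₀) ^ 12 * (6 * (12 : ℕ) / Real.log 2) ^ 12 / η + 1) ≤ s * L →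
        max (2 * R + 8 * s₀ + 1)
        (P * (2 * R + 3 * s₀) ^ 12 * (6 * (12 : ℕ) / Real.log 2) ^ 12 / η + 1) ≤ s * L' →
        L ≤ L' → |Q2 G r β L s f g - Q2 G r β L' s f g| ≤ η := by
      intro L L' hL hL' hLL
      obtain ⟨hN4, henv⟩ := envelope_le hP0 hR0 hs₀ hη (e := 12) (by norm_num) hs hss₀ hL
      obtain ⟨hN4', -⟩ := envelope_le hP0 hR0 hs₀ hη (e := 12) (by norm_num) hs hss₀ hL'
      set N : ℕ := ⌊R / s⌋₊ with hN
      rw [Q2_eq_sum_box r (by omega : N ≤ L) β s f g hvf hvg,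
        Q2_eq_sum_box r (by omega : N ≤ L') β s f g hvf hvg]
      -- the finite-size rate `D`
      set D : ℝ := 2 * ((2 * ((N + 1 : ℕ) : ℝ) + 1) ^ 4 *
        (1 / 2 : ℝ) ^ ((L - 1 - (N + 1)) / 3)) with hD
      have hD0 : 0 ≤ D := by positivity
      have hterm : ∀ x ∈ box 4 N, ∀ y ∈ box 4 N,
          |f (s • siteToE x) * g (s • siteToE y) *
              (torusE G r β L (fun U => dens G r x U * dens G r y U) -
                torusE G r β L (dens G r x) * torusE G r β L (dens G r y)) -
            f (s • siteToE x) * g (s • siteToE y) *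
              (torusE G r β L' (fun U => dens G r x U * dens G r y U) -
                torusE G r β L' (dens G r x) * torusE G r β L' (dens G r y))| ≤
            Mf * Mg * (3 * C ^ 2 * D) := by
        intro x hx y hy
        obtain ⟨h1x, h2xy, -⟩ := hFS β hβ N L L' (by omega) hLL x y x hx hy hx
        obtain ⟨h1y, -, -⟩ := hFS β hβ N L L' (by omega) hLL y x x hy hx hx
        have hcov := abs_cov_sub_cov_le hC0 hD0 h2xy (by simpa only [pow_one] using h1x)
          (by simpa only [pow_one] using h1y) (by simpa only [pow_one] using hE1 β L y)
          (by simpa only [pow_one] using hE1 β L' x)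
        rw [← mul_sub, abs_mul, abs_mul]
        exact mul_le_mul (mul_le_mul (hMf _) (hMg _) (abs_nonneg _) hMf0) hcov (abs_nonneg _)
          (by positivity)
      rw [← Finset.sum_sub_distrib]
      simp_rw [← Finset.sum_sub_distrib]
      calc _ ≤ ∑ x ∈ box 4 N, |∑ y ∈ box 4 N,
            (f (s • siteToE x) * g (s • siteToE y) *
              (torusE G r β L (fun U => dens G r x U * dens G r y U) -
                torusE G r β L (dens G r x) * torusE G r β L (dens G r y)) -
            f (s • siteToE x) * g (s • siteToE y) *
              (torusE G r β L' (fun U => dens G r x U * dens G r y U) -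
                torusE G r β L' (dens G r x) * torusE G r β L' (dens G r y)))| :=
            Finset.abs_sum_le_sum_abs _ _
        _ ≤ ∑ x ∈ box 4 N, ∑ y ∈ box 4 N, Mf * Mg * (3 * C ^ 2 * D) :=
            Finset.sum_le_sum fun x hx => (Finset.abs_sum_le_sum_abs _ _).trans
              (Finset.sum_le_sum fun y hy => hterm x hx y hy)
        _ = (2 * N + 1) ^ 4 * ((2 * N + 1) ^ 4 * (Mf * Mg * (3 * C ^ 2 * D))) := by
            rw [Finset.sum_const, Finset.sum_const, nsmul_eq_mul, nsmul_eq_mul, hcard]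
        _ ≤ P * (2 * (N : ℝ) + 3) ^ 12 * (1 / 2 : ℝ) ^ ((L - 1 - (N + 1)) / 3) := by
            have hX : (2 * (N : ℝ) + 1) ^ 4 ≤ (2 * (N : ℝ) + 3) ^ 4 :=
              pow_le_pow_left₀ (by positivity) (by linarith) 4
            have hY : (2 * ((N + 1 : ℕ) : ℝ) + 1) ^ 4 = (2 * (N : ℝ) + 3) ^ 4 := by
              push_cast; ring
            rw [hD, hY, hP]
            have hq0 : (0 : ℝ) ≤ (1 / 2 : ℝ) ^ ((L - 1 - (N + 1)) / 3) := by positivity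
            have h4 : (0 : ℝ) ≤ (2 * (N : ℝ) + 1) ^ 4 := by positivity
            calc (2 * (N : ℝ) + 1) ^ 4 * ((2 * (N : ℝ) + 1) ^ 4 * (Mf * Mg * (3 * C ^ 2 *
                  (2 * ((2 * (N : ℝ) + 3) ^ 4 * (1 / 2 : ℝ) ^ ((L - 1 - (N + 1)) / 3))))))
                ≤ (2 * (N : ℝ) + 3) ^ 4 * ((2 * (N : ℝ) + 3) ^ 4 * (Mf * Mg * (3 * C ^ 2 *
                  (2 * ((2 * (N : ℝ) + 3) ^ 4 * (1 / 2 : ℝ) ^ ((L - 1 - (N + 1)) / 3)))))) :=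
                  mul_le_mul hX (mul_le_mul_of_nonneg_right hX (by positivity)) (by positivity)
                    (by positivity)
              _ = 6 * Mf * Mg * C ^ 2 * (2 * (N : ℝ) + 3) ^ 12 *
                  (1 / 2 : ℝ) ^ ((L - 1 - (N + 1)) / 3) := by ring
        _ ≤ η := henv
    intro L L' hL hL'
    rcases le_total L L' with hLL | hLL
    · exact key L L' hL hL' hLL
    · rw [abs_sub_comm]; exact key L' L hL' hL hLL
  · intro f g h hf hg hh η hη
    obtain ⟨Mf, Rf, hMf0, hRf0, hMf, hRf⟩ := exists_bound_and_radius f hf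
    obtain ⟨Mg, Rg, hMg0, hRg0, hMg, hRg⟩ := exists_bound_and_radius g hg
    obtain ⟨Mh, Rh, hMh0, hRh0, hMh, hRh⟩ := exists_bound_and_radius h hh
    obtain ⟨R, hR⟩ : ∃ R : ℝ, R = max (max Rf Rg) Rh := ⟨_, rfl⟩
    have hR0 : 0 < R := by rw [hR]; exact lt_max_of_lt_right hRh0
    have hRfR : Rf ≤ R := by rw [hR]; exact (le_max_left _ _).trans (le_max_left _ _)
    have hRgR : Rg ≤ R := by rw [hR]; exact (le_max_right _ _).trans (le_max_left _ _)
    have hRhR : Rh ≤ R := by rw [hR]; exact le_max_right _ _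
    obtain ⟨P, hP⟩ : ∃ P : ℝ, P = 30 * Mf * Mg * Mh * C ^ 3 := ⟨_, rfl⟩
    have hP0 : 0 ≤ P := by rw [hP]; positivity
    refine ⟨max (2 * R + 8 * s₀ + 1)
      (P * (2 * R + 3 * s₀) ^ 16 * (6 * (16 : ℕ) / Real.log 2) ^ 16 / η + 1), ?_⟩
    intro β hβ s hs hss₀
    have hRs : R / s < (⌊R / s⌋₊ : ℕ) + 1 := Nat.lt_floor_add_one _
    have hvf : ∀ x : Site 4, x ∉ box 4 ⌊R / s⌋₊ → f (s • siteToE x) = 0 :=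
      fun x hx => test_vanish hRf hRfR hs hRs hx
    have hvg : ∀ y : Site 4, y ∉ box 4 ⌊R / s⌋₊ → g (s • siteToE y) = 0 :=
      fun y hy => test_vanish hRg hRgR hs hRs hy
    have hvh : ∀ z : Site 4, z ∉ box 4 ⌊R / s⌋₊ → h (s • siteToE z) = 0 :=
      fun z hz => test_vanish hRh hRhR hs hRs hz
    have key : ∀ L L' : ℕ, max (2 * R + 8 * s₀ + 1)
        (P * (2 * R + 3 * s₀) ^ 16 * (6 * (16 : ℕ) / Real.log 2) ^ 16 / η + 1) ≤ s * L →
        max (2 * R + 8 * s₀ + 1)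
        (P * (2 * R + 3 * s₀) ^ 16 * (6 * (16 : ℕ) / Real.log 2) ^ 16 / η + 1) ≤ s * L' →
        L ≤ L' → |Q3 G r β L s f g h - Q3 G r β L' s f g h| ≤ η := by
      intro L L' hL hL' hLL
      obtain ⟨hN4, henv⟩ := envelope_le hP0 hR0 hs₀ hη (e := 16) (by norm_num) hs hss₀ hL
      obtain ⟨hN4', -⟩ := envelope_le hP0 hR0 hs₀ hη (e := 16) (by norm_num) hs hss₀ hL'
      set N : ℕ := ⌊R / s⌋₊ with hN
      rw [Q3_eq_sum_box r (by omega : N ≤ L) β s f g h hvf hvg hvh,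
        Q3_eq_sum_box r (by omega : N ≤ L') β s f g h hvf hvg hvh]
      set D : ℝ := 2 * ((2 * ((N + 1 : ℕ) : ℝ) + 1) ^ 4 *
        (1 / 2 : ℝ) ^ ((L - 1 - (N + 1)) / 3)) with hD
      have hD0 : 0 ≤ D := by positivity
      have hterm : ∀ x ∈ box 4 N, ∀ y ∈ box 4 N, ∀ z ∈ box 4 N,
          |f (s • siteToE x) * g (s • siteToE y) * h (s • siteToE z) *
                torusK3 G r β L x y z -
              f (s • siteToE x) * g (s • siteToE y) * h (s • siteToE z) *
                torusK3 G r β L' x y z| ≤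
            Mf * Mg * Mh * (15 * C ^ 3 * D) := by
        intro x hx y hy z hz
        obtain ⟨h1x, h2xy, h3xyz⟩ := hFS β hβ N L L' (by omega) hLL x y z hx hy hz
        obtain ⟨-, h2xz, -⟩ := hFS β hβ N L L' (by omega) hLL x z x hx hz hx
        obtain ⟨h1y, h2yz, -⟩ := hFS β hβ N L L' (by omega) hLL y z x hy hz hx
        obtain ⟨h1z, -, -⟩ := hFS β hβ N L L' (by omega) hLL z x x hz hx hx
        have hk3 := abs_k3_sub_k3_le hC0 hD0 h3xyz h2xy h2xz h2yz h1x h1y h1z (hE2 β L x y)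
          (hE2 β L x z) (hE2 β L y z) (hE1 β L' x) (hE1 β L' y) (hE1 β L' z) (hE1 β L y)
          (hE1 β L z)
        rw [torusK3, torusK3, ← mul_sub, abs_mul, abs_mul, abs_mul]
        exact mul_le_mul (mul_le_mul (mul_le_mul (hMf _) (hMg _) (abs_nonneg _) hMf0) (hMh _)
          (abs_nonneg _) (by positivity)) hk3 (abs_nonneg _) (by positivity)
      rw [← Finset.sum_sub_distrib]
      simp_rw [← Finset.sum_sub_distrib]
      refine (Finset.abs_sum_le_sum_abs _ _).trans ?_
      refine (Finset.sum_le_sum fun x hx => (Finset.abs_sum_le_sum_abs _ _).trans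
        (Finset.sum_le_sum fun y hy => (Finset.abs_sum_le_sum_abs _ _).trans
          (Finset.sum_le_sum fun z hz => hterm x hx y hy z hz))).trans ?_
      rw [Finset.sum_const, Finset.sum_const, Finset.sum_const, nsmul_eq_mul, nsmul_eq_mul,
        nsmul_eq_mul, hcard]
      have hX : (2 * (N : ℝ) + 1) ^ 4 ≤ (2 * (N : ℝ) + 3) ^ 4 :=
        pow_le_pow_left₀ (by positivity) (by linarith) 4
      have hY : (2 * ((N + 1 : ℕ) : ℝ) + 1) ^ 4 = (2 * (N : ℝ) + 3) ^ 4 := by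
        push_cast; ring
      rw [hD, hY]
      rw [hP] at henv
      calc (2 * (N : ℝ) + 1) ^ 4 * ((2 * (N : ℝ) + 1) ^ 4 * ((2 * (N : ℝ) + 1) ^ 4 *
            (Mf * Mg * Mh * (15 * C ^ 3 *
              (2 * ((2 * (N : ℝ) + 3) ^ 4 * (1 / 2 : ℝ) ^ ((L - 1 - (N + 1)) / 3)))))))
          ≤ (2 * (N : ℝ) + 3) ^ 4 * ((2 * (N : ℝ) + 3) ^ 4 * ((2 * (N : ℝ) + 3) ^ 4 *
            (Mf * Mg * Mh * (15 * C ^ 3 *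
              (2 * ((2 * (N : ℝ) + 3) ^ 4 * (1 / 2 : ℝ) ^ ((L - 1 - (N + 1)) / 3))))))) :=
            mul_le_mul hX (mul_le_mul hX (mul_le_mul_of_nonneg_right hX (by positivity))
              (by positivity) (by positivity)) (by positivity) (by positivity)
        _ = 30 * Mf * Mg * Mh * C ^ 3 * (2 * (N : ℝ) + 3) ^ 16 *
            (1 / 2 : ℝ) ^ ((L - 1 - (N + 1)) / 3) := by ring
        _ ≤ η := henv
    intro L L' hL hL'
    rcases le_total L L' with hLL | hLL
    · exact key L L' hL hL' hLL
    · rw [abs_sub_comm]; exact key L' L hL' hL hLL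

end Functional

/-- **Clauses (a) and (b) of `FixedTorusFirst.FiniteSizeInsensitivity` on the strong-coupling
window, in the crux's own binder shape** (unit map `a`, the reflected test function `θv` against
`v`), for every compact `G` (simple or not) with its Borel σ-algebra: the window `β ≥ β₆` of the
crux is replaced by `|β| ≤ β₀ ∧ a β ≤ s₀`, and the positive-time / disjointness hypotheses on the
test functions are not needed.  A BC5 witness of the crux in a regime where `SomeTorusFloors`,
`NT` and the summit are not known; it says nothing about `β → ∞`. -/
theorem finiteSizeInsensitivity_strongCoupling :
    ∀ (G : Type) [Group G] [TopologicalSpace G] [IsTopologicalGroup G] [CompactSpace G],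
      letI : MeasurableSpace G := borel G
      haveI : BorelSpace G := ⟨rfl⟩
      ∀ (r : LatticeRep G) (a : ℝ → ℝ), (∀ β, 0 < a β) →
        ∃ β₀ : ℝ, 0 < β₀ ∧ ∀ s₀ : ℝ, 0 < s₀ →
          (∀ v : 𝓢(EuclideanSpace ℝ (Fin 4), ℝ),
            HasCompactSupport (v : EuclideanSpace ℝ (Fin 4) → ℝ) → ∀ η : ℝ, 0 < η →
              ∃ Λ₆ : ℝ, ∀ β : ℝ, |β| ≤ β₀ → a β ≤ s₀ → ∀ L L' : ℕ,
                Λ₆ ≤ a β * L → Λ₆ ≤ a β * L' →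
                  |Q2 G r β L (a β) (thetaTest 4 v) v -
                    Q2 G r β L' (a β) (thetaTest 4 v) v| ≤ η) ∧
          (∀ f g h : 𝓢(EuclideanSpace ℝ (Fin 4), ℝ),
            HasCompactSupport (f : EuclideanSpace ℝ (Fin 4) → ℝ) →
            HasCompactSupport (g : EuclideanSpace ℝ (Fin 4) → ℝ) →
            HasCompactSupport (h : EuclideanSpace ℝ (Fin 4) → ℝ) → ∀ η : ℝ, 0 < η →
              ∃ Λ₆ : ℝ, ∀ β : ℝ, |β| ≤ β₀ → a β ≤ s₀ → ∀ L L' : ℕ,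
                Λ₆ ≤ a β * L → Λ₆ ≤ a β * L' →
                  |Q3 G r β L (a β) f g h - Q3 G r β L' (a β) f g h| ≤ η) := by
  intro G _ _ _ _
  letI : MeasurableSpace G := borel G
  haveI : BorelSpace G := ⟨rfl⟩
  intro r a ha
  obtain ⟨β₀, hβ₀, H⟩ := rung_functional_strongCoupling r
  refine ⟨β₀, hβ₀, fun s₀ hs₀ => ⟨fun v hv η hη => ?_, fun f g h hf hg hh η hη => ?_⟩⟩
  · obtain ⟨Λ₆, hΛ⟩ := (H s₀ hs₀).1 (thetaTest 4 v) v
      (hv.comp_homeomorph (timeReflection 4).symm.toHomeomorph) hv η hη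
    exact ⟨Λ₆, fun β hβ hs L L' hL hL' => hΛ β hβ (a β) (ha β) hs L L' hL hL'⟩
  · obtain ⟨Λ₆, hΛ⟩ := (H s₀ hs₀).2 f g h hf hg hh η hη
    exact ⟨Λ₆, fun β hβ hs L L' hL hL' => hΛ β hβ (a β) (ha β) hs L L' hL hL'⟩

end Summit.QuantumFields.YangMills.Cruxes.FiniteSizeInsensitivity.Rung

end
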